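import Summits.Ventures.Crystal3D.Theorems.StickyWulffConstantPolycrystalWulffBoundInterfaceFacetSums
import Summits.Ventures.Crystal3D.Theorems.StickyWulffConstantPolycrystalWulffBoundMinkowskiFacetSlab
import Summits.Ventures.Crystal3D.Theorems.StickyWulffConstantPolycrystalWulffBoundHyperplaneNull
import Summits.Ventures.Crystal3D.Theorems.StickyWulffConstantPolycrystalWulffBoundSeparated

/-!
# `PolycrystalWulffBound`, line `PolyDensity`: sections and wall areas of a cell decomposition adapted
# to parallel wall planes — the bookkeeping `S_f = |wall_f|` for the inclined-lamellar rungs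
# (crux `stmt-Ventures-19482`)

Route `StickyWulffConstant` of the venture `Summits/Ventures/Crystal3D`, second prover lane (poly-p2,
gen 9).  The inclined-lamellar rungs (`PolyDensity.rung_inclinedLamellar_twin(_local)_half`,
`…TwinSectionShiftHolds.lean`) bound `6·2^{1/3}(√2·Vol)^{2/3}` by `Fr + ½·sin∠(n,m)·Σ_f S_f` for ANY
one-sided section bounds `S_f` (`|E ∩ {a_{f+1} − h ≤ ⟪x,n⟫ < a_{f+1}}| ≤ h·S_f` for small `h`).  To
compare with the crux's energy `En` one needs `S_f` = area of the wall `f` (+ε) and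
`ι_{Dsc(m)}(G_f, G_{f+1}) ≥ sin∠ ·` the same area.  For a texture presented by a cell family
`Q_j = polytope (H j)` (pairwise disjoint bounded open polytopes with common-plane unit normals `ν`, as
in clause (B) of `PolytopeCalculus`) with the lamella `f` the union over an index set `s_f`:
* `sin_le_supportFn_cruxDisc` — `√(1 − ⟪ν,m⟫²) ≤ h_{Dsc(m)}(ν)` (unit `m, ν`);
* `facetArea_le_sum_of_subset_iUnion` — a planar piece covered by finitely many pieces has
  `facetArea ≤ Σ facetArea`;
* `crossArea_le_iota_of_polytopeCalculus` — **`sin∠(ν,m) · Σ_{a ∈ s_f, b ∈ s_g} facetArea(Q̄_a ∩ Q̄_b) ≤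
  ι_{Dsc(m)}(G_f, G_g)`** when the common-plane normals between the two families are `±ν`
  (g2's `per_add_per_sub_per_union_eq_crossSum_of_polytopeCalculus`);
* `volume_slab_le_of_cells` — **the one-sided slab bound**: if every cell of `s_f` has the wall
  constraint `(ν, β)`, then for every `ε > 0` there is `h₀ > 0` with
  `|⋃_{s_f} Q ∩ {β − h ≤ ⟪x,ν⟫ < β}| ≤ h·(Σ_{a ∈ s_f} facetArea(Q̄_a ∩ {⟪ν,x⟫ = β}) + ε)` for
  `0 < h < h₀` (g3's `volume_facetSlab_le` cell by cell).
WHAT THIS IS NOT: the texture-form theorem itself (next file); the crux is not claimed. -/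

noncomputable section

open scoped BigOperators InnerProductSpace ENNReal
open MeasureTheory Set

namespace Summit.Ventures.Crystal3D.Theorems

open Summit.Ventures.Crystal3D.Cruxes.TextureLiminf.TexShadow

/-! ### The wall body's support function -/

/-- `√(1 − ⟪ν, m⟫²) ≤ h_{Dsc(m)}(ν)` for unit `m, ν` (`Dsc m = {‖y‖ ≤ 1, y ⊥ m}`): test with the
normalised projection of `ν` on `m^⊥`. -/
theorem sin_le_supportFn_cruxDisc {m ν : E3} (hm : ‖m‖ = 1) (hν : ‖ν‖ = 1) :
    Real.sqrt (1 - ⟪ν, m⟫_ℝ ^ 2) ≤ supportFn {y : E3 | ‖y‖ ≤ 1 ∧ ⟪y, m⟫_ℝ = 0} ν := by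
  have hbdd : BddAbove ((fun y : E3 => ⟪y, ν⟫_ℝ) '' {y : E3 | ‖y‖ ≤ 1 ∧ ⟪y, m⟫_ℝ = 0}) := by
    refine ⟨1, ?_⟩
    rintro _ ⟨y, hy, rfl⟩
    calc ⟪y, ν⟫_ℝ ≤ ‖y‖ * ‖ν‖ := real_inner_le_norm y ν
      _ ≤ 1 * 1 := by rw [hν]; exact mul_le_mul_of_nonneg_right hy.1 zero_le_one
      _ = 1 := one_mul 1
  set y₀ : E3 := ν - ⟪ν, m⟫_ℝ • m with hy₀
  have hmm : ⟪m, m⟫_ℝ = 1 := by rw [real_inner_self_eq_norm_sq, hm, one_pow]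
  have hνν : ⟪ν, ν⟫_ℝ = 1 := by rw [real_inner_self_eq_norm_sq, hν, one_pow]
  have hy₀m : ⟪y₀, m⟫_ℝ = 0 := by
    rw [hy₀, inner_sub_left, real_inner_smul_left, hmm, mul_one, sub_self]
  have hy₀ν : ⟪y₀, ν⟫_ℝ = 1 - ⟪ν, m⟫_ℝ ^ 2 := by
    rw [hy₀, inner_sub_left, real_inner_smul_left, hνν, real_inner_comm m ν, sq]
  have hy₀n : ‖y₀‖ ^ 2 = 1 - ⟪ν, m⟫_ℝ ^ 2 := by
    rw [← real_inner_self_eq_norm_sq, hy₀, inner_sub_left, inner_sub_right, inner_sub_right,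
      real_inner_smul_left, real_inner_smul_left, real_inner_smul_right, real_inner_smul_right, hνν,
      hmm, real_inner_comm m ν]
    ring
  by_cases h0 : y₀ = 0
  · have hz : 1 - ⟪ν, m⟫_ℝ ^ 2 = 0 := by rw [← hy₀n, h0, norm_zero]; ring
    rw [hz, Real.sqrt_zero]
    exact le_csSup hbdd ⟨0, ⟨by simp, by simp⟩, by simp⟩
  · have hpos : 0 < ‖y₀‖ := norm_pos_iff.2 h0
    set y₁ : E3 := ‖y₀‖⁻¹ • y₀ with hy₁
    have hy₁mem : y₁ ∈ {y : E3 | ‖y‖ ≤ 1 ∧ ⟪y, m⟫_ℝ = 0} := by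
      refine ⟨?_, ?_⟩
      · rw [hy₁, norm_smul, norm_inv, norm_norm, inv_mul_cancel₀ hpos.ne']
      · rw [hy₁, real_inner_smul_left, hy₀m, mul_zero]
    have hval : ⟪y₁, ν⟫_ℝ = Real.sqrt (1 - ⟪ν, m⟫_ℝ ^ 2) := by
      rw [hy₁, real_inner_smul_left, hy₀ν, ← hy₀n, Real.sqrt_sq hpos.le, sq, ← mul_assoc,
        inv_mul_cancel₀ hpos.ne', one_mul]
    rw [← hval]
    exact le_csSup hbdd ⟨y₁, hy₁mem, rfl⟩

/-! ### Facet areas under a finite cover -/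

/-- A planar piece covered by finitely many pieces of finite prism volume has `facetArea ≤ Σ`. -/
theorem facetArea_le_sum_of_subset_iUnion {ι : Type*} (s : Finset ι) (F : Set E3) (G : ι → Set E3)
    (ν : E3) (hFG : F ⊆ ⋃ b ∈ s, G b)
    (hfin : ∀ b ∈ s, volume {x : E3 | ∃ y ∈ G b, ∃ t ∈ Set.Icc (0 : ℝ) 1, x = y + t • ν} ≠ ⊤) :
    facetArea F ν ≤ ∑ b ∈ s, facetArea (G b) ν := by
  unfold facetArea
  have hsub : {x : E3 | ∃ y ∈ F, ∃ t ∈ Set.Icc (0 : ℝ) 1, x = y + t • ν} ⊆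
      ⋃ b ∈ s, {x : E3 | ∃ y ∈ G b, ∃ t ∈ Set.Icc (0 : ℝ) 1, x = y + t • ν} := by
    rintro x ⟨y, hy, t, ht, rfl⟩
    obtain ⟨b, hb, hyb⟩ := mem_iUnion₂.1 (hFG hy)
    exact mem_iUnion₂.2 ⟨b, hb, y, hyb, t, ht, rfl⟩
  rw [← ENNReal.toReal_sum hfin]
  exact ENNReal.toReal_mono (ENNReal.sum_ne_top.2 hfin)
    ((measure_mono hsub).trans (measure_biUnion_finset_le s _))

/-- The prism over a piece of the closure of a bounded cell has finite volume. -/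
theorem volume_prism_ne_top_of_isBounded {Q : Set E3} (hQ : Bornology.IsBounded Q) (F : Set E3)
    (hF : F ⊆ closure Q) (ν : E3) :
    volume {x : E3 | ∃ y ∈ F, ∃ t ∈ Set.Icc (0 : ℝ) 1, x = y + t • ν} ≠ ⊤ := by
  obtain ⟨R, hR⟩ := hQ.closure.subset_closedBall 0
  have hsub : {x : E3 | ∃ y ∈ F, ∃ t ∈ Set.Icc (0 : ℝ) 1, x = y + t • ν} ⊆
      Metric.closedBall (0 : E3) (R + ‖ν‖) := by
    rintro x ⟨y, hy, t, ht, rfl⟩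
    have hy' : ‖y‖ ≤ R := by simpa using hR (hF hy)
    rw [Metric.mem_closedBall, dist_zero_right]
    calc ‖y + t • ν‖ ≤ ‖y‖ + ‖t • ν‖ := norm_add_le _ _
      _ ≤ R + ‖ν‖ := by
        rw [norm_smul, Real.norm_eq_abs, abs_of_nonneg ht.1]
        exact add_le_add hy' (by nlinarith [norm_nonneg ν, ht.2])
  exact ne_top_of_le_ne_top (measure_closedBall_lt_top.ne) (measure_mono hsub)

/-! ### The interface term dominates the wall area -/

/-- **`sin∠(ν,m) · (cross wall area) ≤ ι_{Dsc(m)}(G_f, G_g)`.**  Assuming `PolytopeCalculus`: for a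
cell family as in clause (B) and disjoint index sets `sA, sB` such that the common-plane normal of
every pair `(a, b) ∈ sA × sB` is `±ν` (`‖ν‖ = 1`, `‖m‖ = 1`):
`√(1−⟪ν,m⟫²) · Σ_{a ∈ sA} Σ_{b ∈ sB} facetArea(Q̄_a ∩ Q̄_b)(ν_*) ≤
 (per (⋃_{sA} Q) + per (⋃_{sB} Q) − per (⋃_{sA ∪ sB} Q))/2` (the crux's `ι_{Dsc(m)}`). -/
theorem crossArea_le_iota_of_polytopeCalculus (hPC : PolytopeCalculus) {m ν : E3} (hm : ‖m‖ = 1)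
    (hν : ‖ν‖ = 1) {k : ℕ} (H : Fin k → Finset (E3 × ℝ)) (nv : Fin k → Fin k → E3)
    (hbd : ∀ j, Bornology.IsBounded (polytope (H j)))
    (hdisj : ∀ j j', j ≠ j' → Disjoint (polytope (H j)) (polytope (H j')))
    (hplane : ∀ j j', j ≠ j' → ‖nv j j'‖ = 1 ∧ ∃ b : ℝ,
      closure (polytope (H j)) ∩ closure (polytope (H j')) ⊆ {x | ⟪nv j j', x⟫_ℝ = b})
    {sA sB : Finset (Fin k)} (hAB : Disjoint sA sB)
    (hnvν : ∀ a ∈ sA, ∀ b ∈ sB, (nv a b = ν ∨ nv a b = -ν) ∧ (nv b a = ν ∨ nv b a = -ν)) :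
    Real.sqrt (1 - ⟪ν, m⟫_ℝ ^ 2) * ∑ a ∈ sA, ∑ b ∈ sB,
        (if a < b then facetArea (closure (polytope (H a)) ∩ closure (polytope (H b))) (nv a b)
          else facetArea (closure (polytope (H b)) ∩ closure (polytope (H a))) (nv b a)) ≤
      (per {y : E3 | ‖y‖ ≤ 1 ∧ ⟪y, m⟫_ℝ = 0} (⋃ j ∈ sA, polytope (H j)) +
        per {y : E3 | ‖y‖ ≤ 1 ∧ ⟪y, m⟫_ℝ = 0} (⋃ j ∈ sB, polytope (H j)) -
        per {y : E3 | ‖y‖ ≤ 1 ∧ ⟪y, m⟫_ℝ = 0} (⋃ j ∈ sA ∪ sB, polytope (H j))) / 2 := by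
  set K : Set E3 := {y : E3 | ‖y‖ ≤ 1 ∧ ⟪y, m⟫_ℝ = 0} with hK
  have hKc : IsCompact K :=
    Metric.isCompact_of_isClosed_isBounded
      ((isClosed_le continuous_norm continuous_const).inter
        (isClosed_eq (continuous_id.inner continuous_const) continuous_const))
      (Metric.isBounded_closedBall.subset (cruxDisc_subset_closedBall m))
  rw [per_add_per_sub_per_union_eq_crossSum_of_polytopeCalculus hPC hKc (convex_cruxDisc m)
    (zero_mem_cruxDisc m) H nv hbd hdisj hplane hAB, Finset.mul_sum, le_div_iff₀ (by norm_num : (0:ℝ) < 2),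
    Finset.sum_mul]
  refine Finset.sum_le_sum fun a ha => ?_
  rw [Finset.mul_sum, Finset.sum_mul]
  refine Finset.sum_le_sum fun b hb => ?_
  -- the support function of the disc at `±ν` is at least `sin∠(ν, m)`
  have hs : ∀ μ : E3, μ = ν ∨ μ = -ν → Real.sqrt (1 - ⟪ν, m⟫_ℝ ^ 2) ≤ supportFn K μ ∧
      Real.sqrt (1 - ⟪ν, m⟫_ℝ ^ 2) ≤ supportFn K (-μ) := by
    intro μ hμ
    have hnν : ‖-ν‖ = 1 := by rw [norm_neg, hν]
    have h1 := sin_le_supportFn_cruxDisc hm hν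
    have h2 := sin_le_supportFn_cruxDisc hm hnν
    rw [inner_neg_left, neg_sq] at h2
    rcases hμ with rfl | rfl
    · exact ⟨h1, h2⟩
    · rw [neg_neg]; exact ⟨h2, h1⟩
  have hfa : ∀ (S : Set E3) (μ : E3), 0 ≤ facetArea S μ := fun S μ => ENNReal.toReal_nonneg
  obtain ⟨hab, hba⟩ := hnvν a ha b hb
  by_cases hlt : a < b
  · rw [if_pos hlt, if_pos hlt]
    obtain ⟨h1, h2⟩ := hs _ hab
    nlinarith [hfa (closure (polytope (H a)) ∩ closure (polytope (H b))) (nv a b)]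
  · rw [if_neg hlt, if_neg hlt]
    obtain ⟨h1, h2⟩ := hs _ hba
    nlinarith [hfa (closure (polytope (H b)) ∩ closure (polytope (H a))) (nv b a)]

/-! ### One-sided slab volumes below a wall plane -/

/-- **One-sided slab bound from the cells.**  For bounded cells `Q_a = polytope (H a)` with unit
normals, every cell of `s` having the wall constraint `(ν, β)` (so `Q_a ⊆ {⟪ν,x⟫ < β}`), and `ε > 0`,
there is `h₀ > 0` such that for `0 < h < h₀`:
`|⋃_{a ∈ s} Q_a ∩ {β − h ≤ ⟪x,ν⟫ < β}| ≤ h · (Σ_{a ∈ s} facetArea(Q̄_a ∩ {⟪ν,x⟫ = β}) ν + ε)`. -/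
theorem volume_slab_le_of_cells {k : ℕ} (H : Fin k → Finset (E3 × ℝ))
    (hbd : ∀ j, Bornology.IsBounded (polytope (H j))) (hunit : ∀ j, ∀ q ∈ H j, ‖q.1‖ = 1)
    (s : Finset (Fin k)) {ν : E3} (hν : ν ≠ 0) {β : ℝ} (hνβ : ∀ a ∈ s, (ν, β) ∈ H a)
    {ε : ℝ} (hε : 0 < ε) :
    ∃ h₀ : ℝ, 0 < h₀ ∧ ∀ h : ℝ, 0 < h → h < h₀ →
      volume ((⋃ a ∈ s, polytope (H a)) ∩ {x : E3 | β - h ≤ ⟪x, ν⟫_ℝ ∧ ⟪x, ν⟫_ℝ < β}) ≤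
        ENNReal.ofReal (h * (∑ a ∈ s,
          facetArea (closure (polytope (H a)) ∩ {x : E3 | ⟪ν, x⟫_ℝ = β}) ν + ε)) := by
  classical
  set ε' : ℝ := ε / (s.card + 1) with hε'
  have hε'pos : 0 < ε' := by positivity
  have hcard : (s.card : ℝ) * ε' ≤ ε := by
    rw [hε', mul_div_assoc']
    rw [div_le_iff₀ (by positivity)]
    nlinarith
  -- cell-by-cell thresholds
  have hcell : ∀ a : Fin k, ∃ δa : ℝ, 0 < δa ∧ (a ∈ s → ∀ h : ℝ, 0 < h → h < δa →
      (volume (polytope (H a) ∩ {x : E3 | β - h < ⟪ν, x⟫_ℝ})).toReal ≤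
        h * (facetArea (closure (polytope (H a)) ∩ {x : E3 | ⟪ν, x⟫_ℝ = β}) ν + ε')) := by
    intro a
    by_cases ha : a ∈ s
    · by_cases hne : (polytope (H a)).Nonempty
      · obtain ⟨δa, hδa, hb⟩ := volume_facetSlab_le (H a) (hbd a) hne (hunit a) (hνβ a ha) hε'pos
        exact ⟨δa, hδa, fun _ h hh hhδ => hb h hh hhδ⟩
      · refine ⟨1, one_pos, fun _ h hh _ => ?_⟩
        rw [Set.not_nonempty_iff_eq_empty] at hne
        rw [show polytope (H a) = ∅ from hne, Set.empty_inter, measure_empty, ENNReal.toReal_zero]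
        exact mul_nonneg hh.le (add_nonneg ENNReal.toReal_nonneg hε'pos.le)
    · exact ⟨1, one_pos, fun h => absurd h ha⟩
  choose δ hδpos hδP using hcell
  -- a common threshold
  set T : Finset ℝ := insert 1 (s.image δ) with hT
  have hTne : T.Nonempty := ⟨1, Finset.mem_insert_self _ _⟩
  set h₀ : ℝ := T.min' hTne with hh₀
  have hh₀pos : 0 < h₀ := by
    rw [hh₀, Finset.lt_min'_iff]
    intro y hy
    rw [hT, Finset.mem_insert, Finset.mem_image] at hy
    rcases hy with rfl | ⟨a, -, rfl⟩
    · exact one_pos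
    · exact hδpos a
  have hh₀le : ∀ a ∈ s, h₀ ≤ δ a := fun a ha =>
    Finset.min'_le _ _ (by rw [hT, Finset.mem_insert, Finset.mem_image]; exact Or.inr ⟨a, ha, rfl⟩)
  refine ⟨h₀, hh₀pos, fun h hh hhh₀ => ?_⟩
  -- distribute the union and drop the null plane `⟪ν,x⟫ = β − h`
  have hplane : volume {x : E3 | ⟪ν, x⟫_ℝ = β - h} = 0 := volume_setOf_inner_eq_zero hν _
  have hsub : (⋃ a ∈ s, polytope (H a)) ∩ {x : E3 | β - h ≤ ⟪x, ν⟫_ℝ ∧ ⟪x, ν⟫_ℝ < β} ⊆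
      (⋃ a ∈ s, polytope (H a) ∩ {x : E3 | β - h < ⟪ν, x⟫_ℝ}) ∪ {x : E3 | ⟪ν, x⟫_ℝ = β - h} := by
    rintro x ⟨hx, hβ, -⟩
    rw [real_inner_comm] at hβ
    rcases hβ.lt_or_eq with hlt | heq
    · obtain ⟨a, ha, hxa⟩ := mem_iUnion₂.1 hx
      exact Or.inl (mem_iUnion₂.2 ⟨a, ha, hxa, hlt⟩)
    · exact Or.inr heq.symm
  have hfin : ∀ a ∈ s, volume (polytope (H a) ∩ {x : E3 | β - h < ⟪ν, x⟫_ℝ}) ≠ ⊤ := fun a _ =>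
    ne_top_of_le_ne_top (hbd a).measure_lt_top.ne (measure_mono inter_subset_left)
  calc volume ((⋃ a ∈ s, polytope (H a)) ∩ {x : E3 | β - h ≤ ⟪x, ν⟫_ℝ ∧ ⟪x, ν⟫_ℝ < β})
      ≤ volume ((⋃ a ∈ s, polytope (H a) ∩ {x : E3 | β - h < ⟪ν, x⟫_ℝ}) ∪
          {x : E3 | ⟪ν, x⟫_ℝ = β - h}) := measure_mono hsub
    _ ≤ volume (⋃ a ∈ s, polytope (H a) ∩ {x : E3 | β - h < ⟪ν, x⟫_ℝ}) +
          volume {x : E3 | ⟪ν, x⟫_ℝ = β - h} := measure_union_le _ _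
    _ ≤ ∑ a ∈ s, volume (polytope (H a) ∩ {x : E3 | β - h < ⟪ν, x⟫_ℝ}) := by
          rw [hplane, add_zero]; exact measure_biUnion_finset_le s _
    _ ≤ ∑ a ∈ s, ENNReal.ofReal
          (h * (facetArea (closure (polytope (H a)) ∩ {x : E3 | ⟪ν, x⟫_ℝ = β}) ν + ε')) := by
          refine Finset.sum_le_sum fun a ha => ?_
          rw [← ENNReal.ofReal_toReal (hfin a ha)]
          exact ENNReal.ofReal_le_ofReal (hδP a ha h hh (lt_of_lt_of_le hhh₀ (hh₀le a ha)))
    _ = ENNReal.ofReal (∑ a ∈ s,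
          h * (facetArea (closure (polytope (H a)) ∩ {x : E3 | ⟪ν, x⟫_ℝ = β}) ν + ε')) := by
          rw [ENNReal.ofReal_sum_of_nonneg]
          intro a _
          exact mul_nonneg hh.le (add_nonneg ENNReal.toReal_nonneg hε'pos.le)
    _ ≤ ENNReal.ofReal (h * (∑ a ∈ s,
          facetArea (closure (polytope (H a)) ∩ {x : E3 | ⟪ν, x⟫_ℝ = β}) ν + ε)) := by
          refine ENNReal.ofReal_le_ofReal ?_
          rw [← Finset.mul_sum, Finset.sum_add_distrib, Finset.sum_const, nsmul_eq_mul]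
          exact mul_le_mul_of_nonneg_left (by linarith) hh.le

end Summit.Ventures.Crystal3D.Theorems

end
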